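import Summits.Ventures.PercRepro.SixFourResidueThreeGenericTen

/-!
# PercRepro — C-025 at `(6,4)`: the plane-line branch (γ) of the `t = 3` tail, part 0 — the quantitative per-plane bound (p2, gen 9)

Groundwork for half (ii) (proofs/P2-tail-plan.md): for a plane-line solid every plane trace has `≤ g − 3` points, so the
per-pair inequality gives `slack(P) ≥ 0` for every rank-`3` trace, but `J₃ = Σ_P slack(P) − (6/5)·X₂` now has `X₂ > 0`
(Lemma X̄₂: `X₂ ≤ 2g`).  The branch therefore needs the QUANTITATIVE form of the per-pair bound: for any `μ` with
`μ·C(m,2) ≤ L₃(g,p,m)` on every line size `m < p`, `slack(P) ≥ C(p,2)·μ − base₃(g,p)` (`slack_ge_of_mu`) — with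
`μ = min_m L₃(g,p,m)/C(m,2)` this is mine-2's `T₃⁺(g,p)` (§21.16 / §21.18.7), the credit of the big plane and of each
plane through the outside line; and the accounting `J₃ ≥ Σ_{P : r = 3} slack(P) − (6/5)·X₂` for every rank-`4` set
(`J_three_ge_sum_slack_sub`, the non-generic form of `J_three_ge_sum_slack`).  What the branch still needs (not here):
Lemma X̄₂ for every `g` (the landed `X2cnt_le_Xbar2_profile'` is `7 ≤ g ≤ 10`), the plane inventory of a plane-line solid
(the big plane, the `n + s_j`-point planes through `ℓ′`, the rest), and the `(g, n, e, s)`-tables of §21.18.7 at `t = 3`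
(`w3_nonneg.py`) for `15 ≤ g ≤ 100` + the lists `11 ≤ g ≤ 14`.
-/

namespace PercRepro.SixFour

open Finset ThmH

variable {α : Type*} [DecidableEq α] {M : Matroid α} [M.Finite] {G : Finset α}

/-- **The quantitative per-plane bound**: if `μ·C(m,2) ≤ L₃(g,p,m)` for every line size `2 ≤ m < p`, then
`slack(P) ≥ C(p,2)·μ − base₃(g,p)` on a rank-`3` plane trace with `p` points. -/
theorem slack_ge_of_mu (hs : Simple M) (hG : G ⊆ gr M) {P : Finset α}
    (hr : M.eRk ((P ∩ G : Finset α) : Set α) = 3) (μ : ℚ)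
    (hpp : ∀ m, 2 ≤ m → m < (P ∩ G).card → μ * (m.choose 2 : ℚ) ≤ Lterm3 G.card (P ∩ G).card m) :
    ((P ∩ G).card.choose 2 : ℚ) * μ - base3 G.card (P ∩ G).card ≤ slack3 M G P := by
  rw [slack_eq_sum_Lterm3 hs hG hr]
  set ρ := P ∩ G with hρdef
  have hρ : ρ ⊆ gr M := Finset.inter_subset_right.trans hG
  have hterm : ∀ L ∈ lines M, μ * ((L ∩ ρ).card.choose 2 : ℚ) ≤ Lterm3 G.card ρ.card (L ∩ ρ).card := by
    intro L hL
    rcases Nat.lt_or_ge (L ∩ ρ).card 2 with h | h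
    · rw [Lterm3_eq_zero_of_le_one _ _ (by omega)]
      interval_cases hm : (L ∩ ρ).card <;> simp
    · exact hpp _ h (line_lt_trace hr hL)
  have hsum := Finset.sum_le_sum hterm
  have hpairs : ∑ L ∈ lines M, ((L ∩ ρ).card.choose 2 : ℚ) = (ρ.card.choose 2 : ℚ) := by
    exact_mod_cast sum_choose_two_trace hs hρ
  rw [← Finset.mul_sum, hpairs] at hsum
  linarith

/-- **`J₃ ≥ Σ_{P : r(P ∩ G) = 3} slack(P) − (6/5)·X₂`** for every rank-`4` set (the accounting of
`J_three_ge_sum_slack` without genericity). -/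
theorem J_three_ge_sum_slack_sub (hs : Simple M) (hG : G ⊆ gr M) (hr : M.eRk (G : Set α) = 4) (hg : 7 ≤ G.card) :
    ∑ P ∈ (planes M).filter (fun P : Finset α => M.eRk ((P ∩ G : Finset α) : Set α) = 3), slack3 M G P -
      6 / 5 * (X2cnt M G : ℚ) ≤ J M G 3 := by
  set S := (planes M).filter (fun P : Finset α => M.eRk ((P ∩ G : Finset α) : Set α) = 3) with hS
  have F1 := J_three_identity hs hG hr
  have F2 := sum_cost3_le_filter (M := M) G
  have F4 : ∑ P ∈ S, certRHS3 M G P G.card = ∑ P ∈ planes M, certRHS3 M G P G.card := by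
    rw [hS]
    apply Finset.sum_subset (Finset.filter_subset _ _)
    intro P hP hPS
    rw [Finset.mem_filter, not_and] at hPS
    exact certRHS3_eq_zero_of_ne hs hG hP (hPS hP)
  have F56 : ∑ P ∈ planes M, certRHS3 M G P G.card =
      yP3 G.card * ∑ L ∈ lines M, ((L ∩ G).card.choose 2 : ℚ) + ∑ L ∈ lines M, bonus3 (L ∩ G).card +
        ∑ L ∈ lines M, ((eps (L ∩ G).card : ℚ) * ((G.card - (L ∩ G).card).choose 2 : ℚ)) := by
    rw [sum_certRHS3_eq hs hG]
    rw [sum_lines_eq_sum_inc_rat G (fun m => (m.choose 2 : ℚ)), sum_lines_eq_sum_inc_rat G (fun m => bonus3 m),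
      sum_lines_eq_sum_inc_rat G (fun m => (eps m : ℚ) * ((G.card - m).choose 2 : ℚ))]
    rw [Finset.mul_sum, ← Finset.sum_add_distrib, ← Finset.sum_add_distrib]
    refine Finset.sum_congr rfl (fun m hm => ?_)
    rw [Finset.mem_range] at hm
    rcases Nat.lt_or_ge m G.card with hlt | hge
    · rw [price_identity3 hlt]
      unfold bLines
      ring
    · have hm' : m = G.card := by omega
      subst hm'
      rw [show bLines M G G.card = inc M G G.card from rfl, ← show bLines M G G.card = inc M G G.card from rfl,
        bLines_card_eq_zero hr]
      simp
  have F7 : ∑ L ∈ lines M, ((L ∩ G).card.choose 2 : ℚ) = (G.card.choose 2 : ℚ) := by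
    exact_mod_cast sum_choose_two_trace hs hG
  have F9 : ∑ L ∈ lines M, ((eps (L ∩ G).card : ℚ) * ((crossPairs M G L).card : ℚ)) ≤ (lpp M G : ℚ) := by
    have := lpp_ge hs hG
    have h' : ∑ L ∈ lines M, ((eps (L ∩ G).card : ℚ) * ((crossPairs M G L).card : ℚ)) =
        ((∑ L ∈ lines M, eps (L ∩ G).card * (crossPairs M G L).card : ℕ) : ℚ) := by push_cast; rfl
    rw [h']
    exact_mod_cast this
  have F10 : ∑ L ∈ lines M, ((eps (L ∩ G).card : ℚ) * ((G.card - (L ∩ G).card).choose 2 : ℚ)) ≤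
      ∑ L ∈ lines M, ((eps (L ∩ G).card : ℚ) * ((crossPairs M G L).card : ℚ)) + ∑ P ∈ S, (lppCredit M G P : ℚ) := by
    have := sum_eps_choose_le hs hG
    rw [← hS] at this
    have h1 : ∑ L ∈ lines M, ((eps (L ∩ G).card : ℚ) * ((G.card - (L ∩ G).card).choose 2 : ℚ)) =
        ((∑ L ∈ lines M, eps (L ∩ G).card * (G.card - (L ∩ G).card).choose 2 : ℕ) : ℚ) := by push_cast; rfl
    have h2 : ∑ L ∈ lines M, ((eps (L ∩ G).card : ℚ) * ((crossPairs M G L).card : ℚ)) =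
        ((∑ L ∈ lines M, eps (L ∩ G).card * (crossPairs M G L).card : ℕ) : ℚ) := by push_cast; rfl
    have h3 : ∑ P ∈ S, (lppCredit M G P : ℚ) = ((∑ P ∈ S, lppCredit M G P : ℕ) : ℚ) := by push_cast; rfl
    rw [h1, h2, h3, ← Nat.cast_add]
    exact_mod_cast this
  have F11 := F3_eq_yP3 (g := G.card) (by omega)
  have hslack : ∑ P ∈ S, slack3 M G P =
      ∑ P ∈ S, certRHS3 M G P G.card - ∑ P ∈ S, cost3 M G P - ∑ P ∈ S, (lppCredit M G P : ℚ) := by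
    unfold slack3
    rw [Finset.sum_sub_distrib, Finset.sum_sub_distrib]
  rw [hslack, F1]
  rw [F7] at F56
  linarith [F2, F4, F56, F9, F10, F11]

end PercRepro.SixFour
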